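import Summits.AtomisticToContinuum.Crystallization.Theorems.FreeSplittingCertificatesRadiusLadderHardCore

/-!
# Free splitting certificates — hard-core removal on the radius ladder, II: from `2/5` down to every `δ > 0`
(route `FreeSplittingCertificates`, crux r2 `FiniteRangeSplitting`, stmt-AtomisticToContinuum-12559; crux r5
stmt-AtomisticToContinuum-12562)

VALUE = a structural theorem about the crux (it removes the quantifier `∀ δ > 0` of crux r2 down to ONE hard
core `δ₀ = 2/5`) — NOT summit progress.

Iterating the hard-core removal step of part I: the load condition holds from `η = 2/5` down to `s = 3/10`
(`load_two_fifths`) and from every `η = t ≤ 2/5` down to `s = 12 t⁴` (`load_pow_four`); along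
`u₀ = 3/10`, `u_{n+1} = 12 u_n⁴` one has `u_n ≤ (3/10) 3⁻ⁿ`, so the radii used sum to `≤ 2/5 + 9/20 ≤ 1`. Hence

* `rungAt_of_rungAt_two_fifths` : `RungAt (2/5) R → RungAt δ (R + 1)` for every `δ > 0` (`R ≥ 0`), and the
  same for `ε`-rungs (`arungAt_of_arungAt_two_fifths`);
* `finiteRangeSplitting_iff_rung_two_fifths` : crux r2 `↔ ∃ R > 0, RungAt (2/5) R`;
* `approxFiniteRangeSplitting_iff_arung_two_fifths` : crux r5 `↔ ∀ ε > 0, ∃ R > 0, ARungAt (2/5) ε R`;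
* `critSep_eq_zero_or_two_fifths_le` : the critical hard core is `0` or `≥ 2/5` — `RungSet` is `(0, ∞)` or
  contained in `[2/5, ∞)`; `¬` crux r2 `↔ 2/5 ≤ δ_c`;
* `sepThreshold_add_one_eq_zero` : on the radius ladder, `δ*(R) < 2/5 → δ*(R + 1) = 0`.

Limits of the mechanism (informal): with the tree's shell constant `250` the fixed point of the step is `≈ 0.446`;
the attractive load of a close-packed site (`≈ 1.4`) exceeds `V_LJ(4/5)/2 ≈ 0.29`, so no crowding argument of this
kind reaches the LP-certified hard core `4/5` of the `R = 2` rung: the window `[2/5, 4/5)` × large `R` is where crux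
r2 now lives on this ladder.
-/

noncomputable section

open scoped BigOperators Classical
open Literature.MathematicalPhysics.StatisticalMechanics

namespace Summit.AtomisticToContinuum.Crystallization.Theorems.StrictSplittingRuleBirth

/-- Euclidean `3`-space. -/
local notation "E3" => EuclideanSpace ℝ (Fin 3)

/-! ## §6  Iterating the step from `2/5` down to every `δ > 0` -/

/-- The load condition from `η = 2/5` down to `s = 3/10`. -/
theorem load_two_fifths :
    1 / 6 * (250 * (3 / 10 : ℝ)⁻¹ ^ 3 * (8 / 9 : ℝ)⁻¹ ^ 3) ≤ lennardJones (2 / 5) / 2 := by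
  norm_num [lennardJones]

/-- The load condition from `η = t ≤ 2/5` down to `s = 12 t⁴`. -/
theorem load_pow_four {t : ℝ} (ht0 : 0 < t) (ht : t ≤ 2 / 5) :
    1 / 6 * (250 * (12 * t ^ 4)⁻¹ ^ 3 * (8 / 9 : ℝ)⁻¹ ^ 3) ≤ lennardJones t / 2 := by
  have hti : 5 / 2 ≤ t⁻¹ := by rw [inv_eq_one_div, le_div_iff₀ ht0]; linarith
  set w := t⁻¹ ^ 6 with hw_def
  have hw6 : (5 / 2 : ℝ) ^ 6 ≤ w := pow_le_pow_left₀ (by norm_num) hti 6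
  have hw0 : 0 ≤ w := le_trans (by norm_num) hw6
  have h1 : (12 * t ^ 4)⁻¹ ^ 3 = w * w / 1728 := by
    rw [hw_def]; field_simp; ring
  have h2 : lennardJones t = 1 / 12 * (w * w) - 1 / 6 * w := by
    unfold lennardJones; rw [hw_def]; ring
  rw [h1, h2]
  nlinarith [mul_le_mul_of_nonneg_right hw6 hw0]

/-- The hard cores of the iteration: `u₀ = 3/10`, `u_{n+1} = 12 u_n⁴`. -/
def hcSeq : ℕ → ℝ
  | 0 => 3 / 10
  | n + 1 => 12 * hcSeq n ^ 4

/-- The recursion. -/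
theorem hcSeq_succ (n : ℕ) : hcSeq (n + 1) = 12 * hcSeq n ^ 4 := rfl

/-- `0 < u_n`. -/
theorem hcSeq_pos : ∀ n, 0 < hcSeq n
  | 0 => by norm_num [hcSeq]
  | n + 1 => by
    have := hcSeq_pos n
    rw [hcSeq_succ]
    positivity

/-- `u_n ≤ (3/10)·3⁻ⁿ`. -/
theorem hcSeq_le : ∀ n, hcSeq n ≤ 3 / 10 * (1 / 3) ^ n
  | 0 => by norm_num [hcSeq]
  | n + 1 => by
    have h0 := hcSeq_pos n
    have h1 := hcSeq_le n
    have hq : (1 / 3 : ℝ) ^ n ≤ 1 := pow_le_one₀ (by norm_num) (by norm_num)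
    have hq0 : 0 < (1 / 3 : ℝ) ^ n := pow_pos (by norm_num) n
    have h3 : hcSeq n ≤ 3 / 10 := h1.trans (by nlinarith)
    have h4 : hcSeq n ^ 3 ≤ (3 / 10) ^ 3 := pow_le_pow_left₀ h0.le h3 3
    rw [hcSeq_succ, pow_succ]
    calc 12 * hcSeq n ^ 4 = 12 * hcSeq n ^ 3 * hcSeq n := by ring
      _ ≤ 12 * (3 / 10) ^ 3 * (3 / 10 * (1 / 3) ^ n) :=
          mul_le_mul (mul_le_mul_of_nonneg_left h4 (by norm_num)) h1 h0.le (by positivity)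
      _ ≤ 3 / 10 * ((1 / 3) ^ n * (1 / 3)) := by nlinarith

/-- `u_n ≤ 3/10`. -/
theorem hcSeq_le_three_tenths (n : ℕ) : hcSeq n ≤ 3 / 10 :=
  (hcSeq_le n).trans (mul_le_of_le_one_right (by norm_num) (pow_le_one₀ (by norm_num) (by norm_num)))

/-- The radii used by the iteration sum to `≤ 9/20`. -/
theorem sum_hcSeq_le (n : ℕ) : ∑ k ∈ Finset.range n, hcSeq k ≤ 9 / 20 := by
  calc ∑ k ∈ Finset.range n, hcSeq k ≤ ∑ k ∈ Finset.range n, 3 / 10 * (1 / 3 : ℝ) ^ k :=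
        Finset.sum_le_sum fun k _ => hcSeq_le k
    _ = 3 / 10 * ∑ k ∈ Finset.range n, (1 / 3 : ℝ) ^ k := by rw [Finset.mul_sum]
    _ ≤ 3 / 10 * (3 / 2) := by
        refine mul_le_mul_of_nonneg_left ?_ (by norm_num)
        rw [geom_sum_eq (by norm_num : (1 / 3 : ℝ) ≠ 1), div_le_iff_of_neg (by norm_num)]
        have := pow_pos (by norm_num : (0 : ℝ) < 1 / 3) n
        linarith
    _ = 9 / 20 := by norm_num

/-- The iteration: from an `ε`-rung at `(3/10, R)` to `ε`-rungs at `(u_n, R + ∑_{k<n} u_k)`. -/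
theorem arungAt_hcSeq {ε R : ℝ} (hε : 0 ≤ ε) (hR : 0 ≤ R) (h : ARungAt (3 / 10) ε R) :
    ∀ n, ARungAt (hcSeq n) ε (R + ∑ k ∈ Finset.range n, hcSeq k)
  | 0 => by simpa [hcSeq] using h
  | n + 1 => by
    have ih := arungAt_hcSeq hε hR h n
    have hpos := hcSeq_pos n
    have hle := hcSeq_le_three_tenths n
    rw [Finset.sum_range_succ, ← add_assoc]
    refine arungAt_hardCore_step (hcSeq_pos (n + 1)) ?_ (hle.trans (by norm_num))
      (add_nonneg hR (Finset.sum_nonneg fun k _ => (hcSeq_pos k).le)) hε ?_ ih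
    · have h3 : hcSeq n ^ 3 ≤ (3 / 10) ^ 3 := pow_le_pow_left₀ hpos.le hle 3
      rw [hcSeq_succ]
      nlinarith
    · rw [hcSeq_succ]
      exact load_pow_four hpos (hle.trans (by norm_num))

/-- **Hard-core removal (`ε`-rungs).** An `ε`-rung at hard core `2/5` and radius `R ≥ 0` gives an `ε`-rung at
EVERY hard core `δ > 0`, at radius `R + 1`. -/
theorem arungAt_of_arungAt_two_fifths {ε R : ℝ} (hε : 0 ≤ ε) (hR : 0 ≤ R) (h : ARungAt (2 / 5) ε R)
    {δ : ℝ} (hδ : 0 < δ) : ARungAt δ ε (R + 1) := by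
  have h1 : ARungAt (3 / 10) ε (R + 2 / 5) :=
    arungAt_hardCore_step (by norm_num) (by norm_num) (by norm_num) hR hε load_two_fifths h
  obtain ⟨n, hn⟩ : ∃ n : ℕ, (1 / 3 : ℝ) ^ n < δ / (3 / 10) :=
    exists_pow_lt_of_lt_one (by positivity) (by norm_num)
  have hle : hcSeq n ≤ δ := by
    have h' := hcSeq_le n
    rw [lt_div_iff₀ (by norm_num)] at hn
    linarith
  have h2 := arungAt_hcSeq hε (by linarith : (0 : ℝ) ≤ R + 2 / 5) h1 n
  refine arungAt_mono_radius ?_ (arungAt_mono_sep hle h2)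
  have h3 := sum_hcSeq_le n
  linarith

/-- **Hard-core removal.** A rung at hard core `2/5` and radius `R ≥ 0` gives a rung at EVERY hard core
`δ > 0`, at radius `R + 1`. -/
theorem rungAt_of_rungAt_two_fifths {R : ℝ} (hR : 0 ≤ R) (h : RungAt (2 / 5) R) {δ : ℝ} (hδ : 0 < δ) :
    RungAt δ (R + 1) := by
  rw [← arungAt_zero_iff] at h ⊢
  exact arungAt_of_arungAt_two_fifths le_rfl hR h hδ

/-! ## §7  Consequences for crux r2, crux r5 and the critical hard core -/

/-- **Crux r2 is the single rung question at hard core `2/5`**: `FiniteRangeSplitting ↔ ∃ R > 0, RungAt (2/5) R`. -/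
theorem finiteRangeSplitting_iff_rung_two_fifths :
    Summit.AtomisticToContinuum.Crystallization.Theses.FreeSplittingCertificates.FiniteRangeSplitting ↔
      ∃ R : ℝ, 0 < R ∧ RungAt (2 / 5) R := by
  rw [finiteRangeSplitting_iff_rung]
  constructor
  · intro h
    exact h (2 / 5) (by norm_num)
  · rintro ⟨R, hR, h⟩ δ hδ
    exact ⟨R + 1, by linarith, rungAt_of_rungAt_two_fifths hR.le h hδ⟩

/-- **Crux r5 is the `ε`-rung question at hard core `2/5`**:
`ApproxFiniteRangeSplitting ↔ ∀ ε > 0, ∃ R > 0, ARungAt (2/5) ε R`. -/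
theorem approxFiniteRangeSplitting_iff_arung_two_fifths :
    Summit.AtomisticToContinuum.Crystallization.Theses.FreeSplittingCertificates.ApproxFiniteRangeSplitting ↔
      ∀ ε : ℝ, 0 < ε → ∃ R : ℝ, 0 < R ∧ ARungAt (2 / 5) ε R := by
  rw [approxFiniteRangeSplitting_iff_arung]
  constructor
  · intro h ε hε
    exact h (2 / 5) (by norm_num) ε hε
  · intro h δ hδ ε hε
    obtain ⟨R, hR, hr⟩ := h ε hε
    exact ⟨R + 1, by linarith, arungAt_of_arungAt_two_fifths hε.le hR.le hr hδ⟩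

/-- **No small members of `RungSet` unless all**: a hard core `c ≤ 2/5` carrying a rung puts every `δ > 0` in
`RungSet`. -/
theorem mem_rungSet_of_mem_le_two_fifths {c : ℝ} (hc : c ∈ RungSet) (hc25 : c ≤ 2 / 5) {δ : ℝ} (hδ : 0 < δ) :
    δ ∈ RungSet := by
  obtain ⟨R, hR, hr⟩ := (mem_rungSet_of_le hc hc25).2
  exact ⟨hδ, R + 1, by linarith, rungAt_of_rungAt_two_fifths hR.le hr hδ⟩

/-- **Dichotomy for the critical hard core**: `δ_c = 0 ∨ 2/5 ≤ δ_c`. -/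
theorem critSep_eq_zero_or_two_fifths_le : critSep = 0 ∨ 2 / 5 ≤ critSep := by
  by_cases h : 2 / 5 ≤ critSep
  · exact Or.inr h
  · left
    push Not at h
    obtain ⟨R, hR, hr⟩ := (mem_rungSet_of_critSep_lt h).2
    rw [← finiteRangeSplitting_iff_critSep_eq_zero, finiteRangeSplitting_iff_rung_two_fifths]
    exact ⟨R, hR, hr⟩

/-- Equivalently: `¬ FiniteRangeSplitting ↔ 2/5 ≤ δ_c`. -/
theorem not_finiteRangeSplitting_iff_two_fifths_le_critSep :
    ¬ Summit.AtomisticToContinuum.Crystallization.Theses.FreeSplittingCertificates.FiniteRangeSplitting ↔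
      2 / 5 ≤ critSep := by
  rw [not_finiteRangeSplitting_iff_critSep_pos]
  constructor
  · intro h
    exact (critSep_eq_zero_or_two_fifths_le.resolve_left h.ne')
  · intro h
    linarith

/-- **On the radius ladder**: if the separation threshold at radius `R > 0` is below `2/5`, the threshold at
radius `R + 1` vanishes (every hard core carries a rung read at radius `R + 1`). -/
theorem sepThreshold_add_one_eq_zero {R : ℝ} (hR : 0 < R) (h : sepThreshold R < 2 / 5) :
    sepThreshold (R + 1) = 0 := by
  have hmem : (2 / 5 : ℝ) ∈ RungSetAt R := mem_rungSetAt_of_sepThreshold_lt h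
  refine le_antisymm (le_of_forall_gt_imp_ge_of_dense fun δ hδ => ?_) (sepThreshold_nonneg _)
  exact sepThreshold_le_of_mem ⟨hδ, rungAt_of_rungAt_two_fifths hR.le hmem.2 hδ⟩

end Summit.AtomisticToContinuum.Crystallization.Theorems.StrictSplittingRuleBirth

end
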